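import Literature.MathematicalPhysics.QuantumFieldTheory.Balaban1983to89.T4TermwiseBudget
import Literature.MathematicalPhysics.QuantumFieldTheory.Balaban1983to89.T4MatchingClosure
import Summits.QuantumFields.BalabanUV.T4Continuum.Spine.NE7.Targets
import HarnessLib

/-!
# BalabanUVNodes ∕ N19 core knit — YM-DAG node N19 (spine estimate NE7 proper, `Spine.NE7.Core`) KNIT BY NAME from the
# statements of record of its in-edges N16 (NE3) · N17 (NE4) · N18 (NE5) · N22 (NE9 ∧ fading memory) on the term-wise
# road, with every other input of the edge a visible named binder and the SIZE binder in the (2.43)-faithful window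
# profile of the twin file `BalabanUVNodesN19SizeWindow`; then the K5 join (N20 NE7b, N21 NE7c) to `HybridNE7` and node
# U5's TARGET for a string (cell `pub-ymgap`, HUMAN RULING D-0062 Track A, cluster K5 «SpineMatching», seat dag-n19-a;
# count-neutral)

HONEST FRAMING.  One fixed finite four-torus, rung (B)+1 (existence AND uniqueness of the `ε → 0` limit of Bałaban's
unit-scale averaged loop expectations) — NOT infinite volume, NOT a mass gap, NOT the Clay problem.  NE7 — node U5:
the dressed partition functions of two consecutive runs match modulo `t`-independent constants with a SUMMABLE remainder,
`T4CauchySum.MatchingModConstants vol l₀ δ Z ∧ Summable δ` — is NOT PRINTED in [Balaban1987RG1]–[Balaban1989LargeFieldII]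
(one run is constructed and bounded uniformly in `ε`; [Balaban1989LargeFieldII] p. 356 defers even the one-run analysis of
loop observables) and is NOT PROVED here.  Every analytic input below is a HYPOTHESIS SHAPE of the tree consumed BY NAME;
nothing of Bałaban's objects is instantiated; no `def`, 0 `sorry`, standard axioms.  NOT a node discharge (YM-PLAN §1):
the slot `N19_holds` is untouched; this file serves crux `SpineGivenEndpoint` (stmt-QuantumFields-19182) as a `--supports`
helper, and fixes WHICH statement the edge «in-edges ⇒ N19» is, by name, in the route-importable venue (chair R424).

WHAT IS KERNEL-CHECKED ([folklore] throughout — composition of landed tree theorems, finite sums, `Summable` algebra).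
* §1 `termBudget_of_towerRate_sizeProfile` — node U5's per-term budget `T4GoodClassBudget.TermBudget` for the two runs'
  good-class cores `P`, `Q` from a `K`-UNIFORM composed two-run rate of node U3 along the tower
  (`T4TowerRateComposition.URateUpTo K`, ANY producer) and the term-wise END's ledger binders, with the one-run SIZE
  centring allowed a `K`-DEPENDENT profile `S ≤ vol·E_K·a^{K−j}` (the tree's `T4TermwiseBudget.termBudget_of_towerRate`
  fixes `E`; the NE7 pricing desk's watch W-NE7-1 and the twin file's `sizeBinder_of_thm2Printed` show the printed (2.43)
  right side on the recent log window is `vol·E(K+1)^m·a^{K−j}`, not `vol·E·a^{K−j}`); `core_summable_of_termBudget` —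
  `TermBudget` + a summable E-branch ⇒ **`Spine.NE7.Core l₀ vol T Bad P Q δ ∧ Summable δ`** (N19's statement of record
  BY NAME; `= T4GoodClassBudget.GoodClause` by `Iff.rfl`) with the explicit remainder
  `δ K = max(Cw,1)·(E_K + Cr)·Σ_{j+n=K} min(aⁿ, θ′^jΛⁿ) + rO K + s K`; two summability instances: `E_K = E`
  (`T4TowerRateComposition.summable_eBranch_poly`) and `E_K = E(K+1)^m` (the twin's `N19SizeWindow.summable_eBranch_polySize`).
* §2 `core_summable_of_spineNodes` — THE KNIT BY NAME: the in-edge statements OF RECORD enter as literal hypotheses —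
  N16 = `T4EtaRateMin.NE3Shape R C₃ θ₃` (with the realisation convention `T4RateLiaison.GaugeDominated`), N17 =
  `T4CouplingMatching.ScaleShiftRate c θc γ β` (node U2's other displayed inputs — `RGEqH`, box, infrared pin,
  `HistLipschitz`, β-side `FadingMemory`, the UNPRINTED asymptotic-freedom floor `EventualLowerH` behind (0.31) ∕
  [Balaban1987RG1] Thm 2, the smallness — are the binders of `T4CouplingMatching.injectedRate_of_runs_eventual`), N18 =
  `T4OutputRate.NE5 EA EB W κ θ₅ C₅`, N22 = `T4OutputRate.NE9 EA W κ Λ ∧ T4OutputRate.FadingMemory C₉ ω Λ` (ONE conjunction,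
  the venue's `YMDAG.N22` verbatim); plus node U3's PRINTED-INGREDIENT bracket `LipBackground`∕`PolyLipGrowth`
  ([Balaban1988Convergent] (2.27)(ii)–(2.28) p. 259 + a Cauchy estimate; the tree's
  `T4TowerRateDischarge.lipBackground_of_analyticMargin` ∕ `uRateUpTo_of_margin` discharge it to the margin reading and plug
  into §1 verbatim), the format binders, the (2.43)-window size profile, and hazard H-U5b-1 asked UNIFORMLY in the
  (existentially produced) tower constant ⇒ `∃ δ, Spine.NE7.Core l₀ vol T Bad P Q δ ∧ Summable δ`
  (`T4TowerRateDischarge.uRateUpTo_of_spine` + §1).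
* §3 `hybridNE7_of_core_exists` ∕ `target_of_core_exists` — THE K5 JOIN for this clause: N20 (`RelWeightBound`, NE7b),
  N21 (`ShellWeightBound`, NE7c), `W + Wsh < 1`, and N19 ∧ U4′ as §2 delivers them on the shell-free cores `A − shA`,
  `B − shB` ⇒ `HybridNE7` (`Spine.NE7.hybridNE7_of_core` BY NAME, as in the crux's BC3 skeleton); with the E1∕E2 dictionary
  of a `TorusScheme` string from `K₀` on ⇒ node U5's TARGET `∃ δ′, Spine.NE7.Target vol l₀ δ′ (schemeZ S os)`
  (`T4MatchingClosure.stringHybridNE7_intro` + `T4MatchingAssembly.matchingModConstants_schemeZ`), the YM-DAG's `N19target`.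

BINDER CENSUS OF THE EDGE «in-edges ⇒ N19» (what is NOT a sibling node's statement; each NOT PRINTED as a two-run
statement unless marked).  (F) TERM FORMAT ∕ synchronisation `hfmtA hfmtB hint hposO hoff` — node U5a∕U5d: both runs' good
terms are pending positive integrals over a COMMON space of driving fields against a COMMON ledger of (2.25)-shaped
E-factors read on NE3's reading family (print's one-run inventory (2.23)∕(2.25)–(2.27) p. 259 of [Balaban1988Convergent],
(1.98)–(1.104) pp. 390–391 of [Balaban1989LargeFieldII] is a LOCATION only; the two-run class expansion itself is the
dagwriter's stub N27x ∕ the crux's `stub_classExpansionAtRecord`).  (S) one-run SIZE centring `hS hSle` — PRINTED-GRADE: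
[III] Thm 2 (2.43) p. 263 on the recent log window, node N11's leaf, read by the twin's `sizeBinder_of_thm2Printed`.
(M) MULTIPLICITY `hM` — PRINTED-GRADE one run ((0.26) p. 257 of [Balaban1987RG1]; node N09's `B12.chain026_holds`), a
hypothesis for the two-run ledger.  (O) OTHER KINDS `hO hRO hrO` — R-kind, boundary kind, run B's unmatched first step, the
observable-attached D-terms of node N14: their two-run rates are the sibling rows' and enter here only as the aggregate
`rO` (the located routes: `T4BoundaryCarrier`∕`T4BoundaryRate`, NE-R1's `uv_*` fields of `T4MatchingClosure.ReindexedBudget`,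
`Spine/NE1p`).  (D) hazard H-U5b-1 `hdevU` — reduced in the tree to `T4GoodClassBudget.RecentDeviation` + window
multiplicity (`abs_sub_centre_le_windowSum`).  (T) node U3's Lipschitz-in-the-background `hU hG` — PRINTED-GRADE
((2.27)(ii)–(2.28) + Cauchy).  So the three brackets of `T4OutputRate.u3_threeBrackets` are, at node level: argument = N16 ×
(T), coupling = N22 × N17, functional = N18 — none is N19's own; N19's OWN unprinted content on this road is (F) + (D), the
weight half being N20∕N21.  FIRST MISSING ESTIMATE for the -b lane: (F) — the synchronised two-run term format at the
carriers of record (no tree object; it is where `S_N27x` and `stub_classExpansionAtRecord` live).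

CITATION HEADER (printed context = LOCATIONS only, as transcribed in the headers of the imported modules `T4RecentScale`,
`T4GoodClassBudget`, `T4TermwiseBudget`, `T4TowerRateDischarge`, `T4MatchingClosure`; no decl below carries a cite tag).
[Balaban1988Convergent] T. Bałaban, *Convergent renormalization expansions for lattice gauge theories*, Commun. Math. Phys.
**119** (1988) 243–285 — (2.25)–(2.27) p. 259, (2.27)(ii)–(2.28) p. 259, Thm 2 (2.43) p. 263.  [Balaban1987RG1] T. Bałaban,
CMP **109** (1987) 249–301 — (0.26) p. 257; (0.31) and Thm 2 p. 259 («A proof of this theorem … will be given in a separate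
paper» — the conditional behind `EventualLowerH`, NEVER used as a result).  [Balaban1989LargeFieldII] T. Bałaban, CMP **122**
(1989) 355–392 — Thm 1 p. 355 (the rung BELOW), p. 356, (1.98)–(1.104) pp. 390–391.  [King1986] C. King, CMP **102** (1986)
649–677, (3.10)–(3.13) pp. 656–657 — printed TEMPLATE of the hybrid split, context only.
-/

open Finset MeasureTheory

namespace Summit.QuantumFields.YangMills.BalabanUVNodes.N19CoreKnit

open Literature.MathematicalPhysics.QuantumFieldTheory.Balaban1983to89
open T4OutputRate T4RecentScale T4GoodClassBudget T4CauchySum T4TowerRateComposition T4TowerRateDischarge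
open T4TermwiseBudget T4MatchingAssembly T4MatchingClosure T4WeightBudget T4IndicatorShell
open T4EtaRateMin (Readings LocalRate NE3Shape)
open T4RateLiaison (GaugeDominated)
open Summit.QuantumFields.BalabanUV.T4Continuum.Spine
open T4Crossover (crossoverRate_lt_one sum_min_pow_le_crossover)

/-! ## §1 The edge in generic form: a `K`-uniform tower rate + the END's ledger binders (size profile free) ⇒ `Core ∧ Summable δ` -/

section Generic

variable {C : Carriers} {ι : Type*} [MeasurableSpace ι] {σ : Type*} [DecidableEq σ] {l₀ vol : ℝ}
  {T : ℕ → Finset σ} {Bad : ℕ → ℝ → Finset σ} {P Q : ℕ → ℝ → σ → ℝ} {μ : ℕ → ℝ → σ → Measure ι}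
  {fac : ℕ → ℝ → σ → Finset C.Dom} {dom : Set ι} {EA : Functional C C.BgA} {EB : Functional C C.BgB}
  {g : ℕ → ℕ → ℝ} {uA : ℕ → ι → C.BgA} {uB : ℕ → ι → C.BgB} {oneA : C.BgA} {oneB : C.BgB}
  {oA oB : ℕ → ℝ → σ → ι → ℝ} {κ₁ S : ℕ → ℝ → σ → ℕ → ℝ} {cO RO : ℕ → ℝ → σ → ℝ} {rO c₀ s E : ℕ → ℝ}
  {Cw a Λg κ θ' Cr : ℝ}

/-- **NODE U5's PER-TERM BUDGET FROM A `K`-UNIFORM TOWER RATE, SIZE PROFILE FREE.**  HYPOTHESES (binders; none printed as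
a two-run statement): `hUK` — node U3 composed along the tower with ONE constant `Cr ≥ 0` and rate `θ′ ≥ 0` between run A
(`g K`, backgrounds `uA K v`) and run B (re-indexed `i ↦ g (K+1) (i+1)`, `uB K v`) on the admissible data `dom`; the TERM
FORMAT of the good-class cores `P`, `Q` as pending positive integrals of the (2.25)-shaped E-ledger `fac K t τ` (creation
scales `≤ K`) times the other kinds `oA`, `oB`; integrability; positivity of the other kinds on `dom` and vanishing of
both densities off `dom`; the one-run SIZE centring `κ₁, S` with the profile `S ≤ vol·E_K·a^{K−j}`, `E_K ≥ 0`;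
MULTIPLICITY with base `Λ ≥ 0`; other kinds centred at `cO` within `RO ≤ vol·rO K`; hazard H-U5b-1 on the chosen centres.
CONCLUSION: `TermBudget` with explicit centred constants ∕ radii and remainder rate
`max(Cw,1)·(E_K + Cr)·Σ_{j+n=K} min(aⁿ, θ′^jΛⁿ) + rO K` (rate centring produced by
`T4TermwiseBudget.rateSlice_of_uRateUpTo`, the sandwich by `term_sandwich_of_centring`, the radius by `sliceMin_le_eShape` at
`E := E_K`). [folklore] -/
theorem termBudget_of_towerRate_sizeProfile
    (hUK : ∀ K, URateUpTo K EA EB (g K) (fun i => g (K + 1) (i + 1)) (uA K) (uB K) dom Cr θ' κ)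
    (hCr : 0 ≤ Cr) (hθ'0 : 0 ≤ θ') (hΛ : 0 ≤ Λg)
    (hfmtA : ∀ K t τ, P K t τ = ∫ v, (∏ X ∈ fac K t τ,
      Real.exp (EA (g K) (uA K v) X - EA (g K) oneA X)) * oA K t τ v ∂(μ K t τ))
    (hfmtB : ∀ K t τ, Q K t τ = ∫ v, (∏ X ∈ fac K t τ,
      Real.exp (EB (fun i => g (K + 1) (i + 1)) (uB K v) X - EB (fun i => g (K + 1) (i + 1)) oneB X)) *
        oB K t τ v ∂(μ K t τ))
    (hint : ∀ K t, |t| ≤ l₀ → ∀ τ ∈ T K \ Bad K t,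
      Integrable (fun v => (∏ X ∈ fac K t τ, Real.exp (EA (g K) (uA K v) X - EA (g K) oneA X)) *
        oA K t τ v) (μ K t τ) ∧
      Integrable (fun v => (∏ X ∈ fac K t τ,
        Real.exp (EB (fun i => g (K + 1) (i + 1)) (uB K v) X - EB (fun i => g (K + 1) (i + 1)) oneB X)) *
        oB K t τ v) (μ K t τ))
    (hsc : ∀ K t, |t| ≤ l₀ → ∀ τ ∈ T K \ Bad K t, ∀ X ∈ fac K t τ, C.scale X ≤ K)
    (hposO : ∀ K t, |t| ≤ l₀ → ∀ τ ∈ T K \ Bad K t, ∀ v ∈ dom, 0 < oA K t τ v ∧ 0 < oB K t τ v)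
    (hoff : ∀ K t, |t| ≤ l₀ → ∀ τ ∈ T K \ Bad K t, ∀ v, v ∉ dom →
      (∏ X ∈ fac K t τ, Real.exp (EA (g K) (uA K v) X - EA (g K) oneA X)) * oA K t τ v = 0 ∧
      (∏ X ∈ fac K t τ,
        Real.exp (EB (fun i => g (K + 1) (i + 1)) (uB K v) X - EB (fun i => g (K + 1) (i + 1)) oneB X)) *
        oB K t τ v = 0)
    (hS : ∀ K t, |t| ≤ l₀ → ∀ τ ∈ T K \ Bad K t, ∀ v ∈ dom, ∀ j ≤ K,
      |(∑ X ∈ fac K t τ with C.scale X = j,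
          (Real.log (Real.exp (EB (fun i => g (K + 1) (i + 1)) (uB K v) X
              - EB (fun i => g (K + 1) (i + 1)) oneB X))
            - Real.log (Real.exp (EA (g K) (uA K v) X - EA (g K) oneA X)))) - κ₁ K t τ j| ≤ S K t τ j)
    (hM : ∀ K t, |t| ≤ l₀ → ∀ τ ∈ T K \ Bad K t,
      Multiplicity (fac K t τ) C.scale (fun X => Real.exp (-(κ * C.d X))) Cw vol Λg K)
    (hO : ∀ K t, |t| ≤ l₀ → ∀ τ ∈ T K \ Bad K t, ∀ v ∈ dom,
      |Real.log (oB K t τ v) - Real.log (oA K t τ v) - cO K t τ| ≤ RO K t τ)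
    (hvol : 0 ≤ vol) (hE : ∀ K, 0 ≤ E K) (ha : 0 ≤ a)
    (hSle : ∀ K t, |t| ≤ l₀ → ∀ τ ∈ T K \ Bad K t, ∀ j ≤ K, S K t τ j ≤ vol * (E K * a ^ (K - j)))
    (hRO : ∀ K t, |t| ≤ l₀ → ∀ τ ∈ T K \ Bad K t, RO K t τ ≤ vol * rO K)
    (hdev : ∀ K t, |t| ≤ l₀ → ∀ τ ∈ T K \ Bad K t,
      |((∑ j ∈ range (K + 1), sliceCentre (κ₁ K t τ)
          (fun j => ∑ X ∈ fac K t τ with C.scale X = j,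
            (-(EB (fun i => g (K + 1) (i + 1)) oneB X - EA (g K) oneA X)))
          (S K t τ) (fun j => Cw * vol * (Cr * θ' ^ j * Λg ^ (K - j))) j) + cO K t τ) - c₀ K| ≤ vol * s K) :
    TermBudget l₀ vol T P Q Bad
      (fun K t τ => (∑ j ∈ range (K + 1), sliceCentre (κ₁ K t τ)
          (fun j => ∑ X ∈ fac K t τ with C.scale X = j,
            (-(EB (fun i => g (K + 1) (i + 1)) oneB X - EA (g K) oneA X)))
          (S K t τ) (fun j => Cw * vol * (Cr * θ' ^ j * Λg ^ (K - j))) j) + cO K t τ)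
      (fun K t τ => (∑ j ∈ range (K + 1), min (S K t τ j) (Cw * vol * (Cr * θ' ^ j * Λg ^ (K - j)))) + RO K t τ)
      c₀ (fun K => max Cw 1 * ((E K + Cr) * ∑ x ∈ antidiagonal K, min (a ^ x.2) (θ' ^ x.1 * Λg ^ x.2)) + rO K)
      s := by
  -- per good term: positivity of the ledger × other kinds on `dom`, and the rate centring from the tower rate
  have hpos : ∀ K t, |t| ≤ l₀ → ∀ τ ∈ T K \ Bad K t, ∀ v ∈ dom,
      (∀ X ∈ fac K t τ, 0 < Real.exp (EA (g K) (uA K v) X - EA (g K) oneA X) ∧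
        0 < Real.exp (EB (fun i => g (K + 1) (i + 1)) (uB K v) X - EB (fun i => g (K + 1) (i + 1)) oneB X)) ∧
      0 < oA K t τ v ∧ 0 < oB K t τ v := fun K t ht τ hτ v hv =>
    ⟨fun _ _ => ⟨Real.exp_pos _, Real.exp_pos _⟩, hposO K t ht τ hτ v hv⟩
  have hρ : ∀ K t, |t| ≤ l₀ → ∀ τ ∈ T K \ Bad K t, ∀ v ∈ dom, ∀ j ≤ K,
      |(∑ X ∈ fac K t τ with C.scale X = j,
          (Real.log (Real.exp (EB (fun i => g (K + 1) (i + 1)) (uB K v) X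
              - EB (fun i => g (K + 1) (i + 1)) oneB X))
            - Real.log (Real.exp (EA (g K) (uA K v) X - EA (g K) oneA X))))
        - ∑ X ∈ fac K t τ with C.scale X = j, (-(EB (fun i => g (K + 1) (i + 1)) oneB X - EA (g K) oneA X))|
        ≤ Cw * vol * (Cr * θ' ^ j * Λg ^ (K - j)) := fun K t ht τ hτ v hv j hj =>
    rateSlice_of_uRateUpTo (hUK K) oneA oneB (hsc K t ht τ hτ) (hM K t ht τ hτ) hCr hθ'0 hv hj
  refine ⟨fun K t ht τ hτ => ?_, fun K t ht τ hτ => ?_, fun K t ht τ hτ => ?_, fun K t ht τ hτ => ?_, hdev⟩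
  · rw [hfmtA]
    exact (term_sandwich_of_centring (hsc K t ht τ hτ) (hpos K t ht τ hτ) (hoff K t ht τ hτ) (hS K t ht τ hτ)
      (hρ K t ht τ hτ) (hO K t ht τ hτ) (hint K t ht τ hτ).1 (hint K t ht τ hτ).2).1
  · rw [hfmtA, hfmtB]
    exact (term_sandwich_of_centring (hsc K t ht τ hτ) (hpos K t ht τ hτ) (hoff K t ht τ hτ) (hS K t ht τ hτ)
      (hρ K t ht τ hτ) (hO K t ht τ hτ) (hint K t ht τ hτ).1 (hint K t ht τ hτ).2).2.1
  · rw [hfmtA, hfmtB]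
    exact (term_sandwich_of_centring (hsc K t ht τ hτ) (hpos K t ht τ hτ) (hoff K t ht τ hτ) (hS K t ht τ hτ)
      (hρ K t ht τ hτ) (hO K t ht τ hτ) (hint K t ht τ hτ).1 (hint K t ht τ hτ).2).2.2
  · have h1 := sliceMin_le_eShape hvol (hE K) ha hθ'0 hΛ hCr (hSle K t ht τ hτ)
      (fun j (_ : j ≤ K) => le_refl (Cw * vol * (Cr * θ' ^ j * Λg ^ (K - j))))
    have h2 := hRO K t ht τ hτ
    show (∑ j ∈ range (K + 1), min (S K t τ j) (Cw * vol * (Cr * θ' ^ j * Λg ^ (K - j)))) + RO K t τ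
      ≤ vol * (max Cw 1 * ((E K + Cr) * ∑ x ∈ antidiagonal K, min (a ^ x.2) (θ' ^ x.1 * Λg ^ x.2)) + rO K)
    rw [mul_add]
    exact add_le_add h1 h2

/-- **NODE N19 ∧ U4′ FROM THE BUDGET**: a per-term budget with remainder rate
`max(Cw,1)·(E_K + Cr)·Σ_{j+n=K} min(aⁿ, θ′^jΛⁿ) + rO K`, a SUMMABLE E-branch, summable `rO` and `s` give
**`Spine.NE7.Core l₀ vol T Bad P Q δ`** — N19's statement of record BY NAME (`= GoodClause`, `Iff.rfl`) — with
`δ = r + s` AND `Summable δ` (`T4GoodClassBudget.goodClause_of_termBudget`). [folklore] -/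
theorem core_summable_of_termBudget {Cc Rr : ℕ → ℝ → σ → ℝ}
    (hT : TermBudget l₀ vol T P Q Bad Cc Rr c₀
      (fun K => max Cw 1 * ((E K + Cr) * ∑ x ∈ antidiagonal K, min (a ^ x.2) (θ' ^ x.1 * Λg ^ x.2)) + rO K) s)
    (hsum : Summable (fun K => (E K + Cr) * ∑ x ∈ antidiagonal K, min (a ^ x.2) (θ' ^ x.1 * Λg ^ x.2)))
    (hrO : Summable rO) (hs : Summable s) :
    NE7.Core l₀ vol T Bad P Q
        (fun K => (max Cw 1 * ((E K + Cr) * ∑ x ∈ antidiagonal K, min (a ^ x.2) (θ' ^ x.1 * Λg ^ x.2)) + rO K)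
          + s K) ∧
      Summable (fun K => (max Cw 1 * ((E K + Cr) * ∑ x ∈ antidiagonal K, min (a ^ x.2) (θ' ^ x.1 * Λg ^ x.2))
          + rO K) + s K) :=
  ⟨goodClause_of_termBudget hT, ((hsum.mul_left (max Cw 1)).add hrO).add hs⟩

/-- The E-branch with a CONSTANT size letter `E_K = E` is summable for `0 < a < 1`, `0 < θ′ < 1`, `θ′ ≤ Λ`
(`T4TowerRateComposition.summable_eBranch_poly` at `p = 0` — the all-regular binder of the tree's route). [folklore] -/
theorem summable_eBranch_const {E₀ : ℝ} (hE : 0 ≤ E₀) (hCr : 0 ≤ Cr) (ha0 : 0 < a) (ha1 : a < 1) (hθ'0 : 0 < θ')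
    (hθ'1 : θ' < 1) (hθ'Λ : θ' ≤ Λg) :
    Summable (fun K : ℕ => (E₀ + Cr) * ∑ x ∈ antidiagonal K, min (a ^ x.2) (θ' ^ x.1 * Λg ^ x.2)) := by
  refine (summable_eBranch_poly (p := 0) hE hCr ha0 ha1 hθ'0 hθ'1 hθ'Λ).congr fun K => ?_
  rw [pow_zero, mul_one]

/-- The E-branch with the (2.43)-FAITHFUL size letter `E_K = E(K+1)^m` (the printed right side of [III] Thm 2 (2.43) on
the recent log window — twin file `BalabanUVNodesN19SizeWindow`, `sizeBinder_of_thm2Printed` ∕ `summable_eBranch_polySize`,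
whose `p = 0` case this is; re-proved here so that this module does not wait on that module's build) is summable for
`0 < a < 1`, `0 < θ′ < 1`, `θ′ ≤ Λ`: comparison with `(K+1)^{m+1} q^K`, `q < 1` the crossover rate of
`T4Crossover.sum_min_pow_le_crossover`. [folklore] -/
theorem summable_eBranch_windowSize {E₀ : ℝ} {m : ℕ} (hE : 0 ≤ E₀) (hCr : 0 ≤ Cr) (ha0 : 0 < a) (ha1 : a < 1)
    (hθ'0 : 0 < θ') (hθ'1 : θ' < 1) (hθ'Λ : θ' ≤ Λg) :
    Summable (fun K : ℕ =>
      (E₀ * ((K : ℝ) + 1) ^ m + Cr) * ∑ x ∈ antidiagonal K, min (a ^ x.2) (θ' ^ x.1 * Λg ^ x.2)) := by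
  set q := θ' ^ (Real.log (1 / a) / (Real.log (Λg / θ') + Real.log (1 / a))) with hq
  have hq0 : 0 ≤ q := Real.rpow_nonneg hθ'0.le _
  have hq1 : q < 1 := crossoverRate_lt_one ha0 ha1 hθ'0 hθ'1 hθ'Λ
  have h1 := (summable_succ_pow_mul_geometric hq0 hq1 (m + 1)).mul_left E₀
  have h2 := (summable_succ_pow_mul_geometric hq0 hq1 1).mul_left Cr
  have hbound : Summable (fun K : ℕ => (E₀ * ((K : ℝ) + 1) ^ m + Cr) * (((K : ℝ) + 1) * q ^ K)) := by
    refine (h1.add h2).congr fun K => ?_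
    rw [pow_succ, pow_one]
    ring
  refine Summable.of_nonneg_of_le (fun K => ?_) (fun K => ?_) hbound
  · exact mul_nonneg (add_nonneg (mul_nonneg hE (by positivity)) hCr) (Finset.sum_nonneg fun x _ =>
      le_min (pow_nonneg ha0.le _) (mul_nonneg (pow_nonneg hθ'0.le _) (pow_nonneg (hθ'0.le.trans hθ'Λ) _)))
  · exact mul_le_mul_of_nonneg_left (sum_min_pow_le_crossover ha0 ha1 hθ'0 hθ'Λ K)
      (add_nonneg (mul_nonneg hE (by positivity)) hCr)

end Generic

/-! ## §2 THE KNIT BY NAME: N16 (NE3) · N17 (NE4) · N18 (NE5) · N22 (NE9 ∧ fading memory) ⇒ N19 ∧ U4′ -/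

section SpineNodes

open FlowStep T4CouplingMatching

variable {C : Carriers} {ι X : Type} [MeasurableSpace ι] {σ : Type*} [DecidableEq σ] {l₀ vol : ℝ}
  {T : ℕ → Finset σ} {Bad : ℕ → ℝ → Finset σ} {P Q : ℕ → ℝ → σ → ℝ} {μ : ℕ → ℝ → σ → Measure ι}
  {fac : ℕ → ℝ → σ → Finset C.Dom} {R : Readings ι X} {W : Set (ℕ → ℝ)} {EA : Functional C C.BgA}
  {EB : Functional C C.BgB} {β : HBeta} {κ θ₅ C₅ C₉ ω θc γ b c Cβ C₃ θ₃ Pg θ' : ℝ} {q k₀ m : ℕ} {Λ Λβ : ℕ → ℕ → ℝ}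
  {CU : (ℕ → ℝ) → ℕ → ℝ} {g : ℕ → ℕ → ℝ} {uA : ℕ → ι → C.BgA} {uB : ℕ → ι → C.BgB} {oneA : C.BgA} {oneB : C.BgB}
  {oA oB : ℕ → ℝ → σ → ι → ℝ} {κ₁ S : ℕ → ℝ → σ → ℕ → ℝ} {cO RO : ℕ → ℝ → σ → ℝ} {rO : ℕ → ℝ} {Cw E₀ a Λg : ℝ}

/-- **NODE N19 KNIT BY NAME FROM ITS IN-EDGES' STATEMENTS OF RECORD.**  The sibling nodes of the YM-DAG enter as LITERAL
hypotheses: `h16 : T4EtaRateMin.NE3Shape R C₃ θ₃` (N16, NE3 — both readings of consecutive runs' minimisers at a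
geometric rate `0 ≤ θ₃ < 1`; realisation convention `GaugeDominated R uA uB`); `h17 : T4CouplingMatching.ScaleShiftRate c θc
γ β` (N17, NE4 — with node U2's displayed inputs `hrun hbox hpin hL hΛβ hlo hsmall`, `hlo` being the UNPRINTED
asymptotic-freedom floor `EventualLowerH` behind (0.31)); `h18 : T4OutputRate.NE5 EA EB W κ θ₅ C₅` (N18); `h22 :
T4OutputRate.NE9 EA W κ Λ ∧ T4OutputRate.FadingMemory C₉ ω Λ` (N22, the venue's conjunction).  Further binders: node U3's
printed-ingredient bracket `hU hG` (Lipschitz-in-the-background with polynomial growth), both runs' re-indexed couplings in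
the window, a common rate `θ′ < 1` above `max(ω, θc)`, `θ₅`, `θ₃` and below the multiplicity base `Λ`; the END's format
binders (§1) on NE3's admissible data `R.dom`; the SIZE binder in the (2.43)-window profile `S ≤ vol·E(K+1)^m·a^{K−j}`
(`m = 0` = the tree's all-regular binder); hazard H-U5b-1 UNIFORMLY in the rate constant.  CONCLUSION: `∃ δ,
Spine.NE7.Core l₀ vol T Bad P Q δ ∧ Summable δ` — node N19 AND the `summable` leaf of `HybridNE7` for these cores.  Proof:
`T4TowerRateDischarge.uRateUpTo_of_spine`, then §1.  CONDITIONAL on every binder; nothing of Bałaban's is instantiated;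
NOT NE7. [folklore] -/
theorem core_summable_of_spineNodes (gIR : ℝ)
    -- the in-edges BY NAME
    (h16 : NE3Shape R C₃ θ₃) (hC₃ : 0 ≤ C₃) (hgd : GaugeDominated R uA uB)
    (h17 : ScaleShiftRate c θc γ β)
    (h18 : NE5 EA EB W κ θ₅ C₅) (hθ₅ : 0 ≤ θ₅) (hC₅ : 0 ≤ C₅)
    (h22 : NE9 EA W κ Λ ∧ T4OutputRate.FadingMemory C₉ ω Λ) (hω : 0 ≤ ω)
    -- node U2's other displayed inputs (binders of `injectedRate_of_runs_eventual`)
    (hγ : 0 < γ) (hb : 0 < b) (hθc0 : 0 < θc) (hθc1 : θc < 1) (hc : 0 ≤ c) (hCβ : 0 ≤ Cβ)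
    (hrun : ∀ K, RGEqH K β (g K)) (hbox : ∀ K i, i ≤ K → 0 < g K i ∧ g K i ≤ γ) (hpin : ∀ K, g K K = gIR)
    (hL : HistLipschitz Λβ γ β) (hΛβ : T4CouplingMatching.FadingMemory Cβ θc Λβ)
    (hlo : EventualLowerH b γ k₀ β) (hsmall : Cβ * (((k₀ : ℝ) + 1) * γ ^ 3 + 2 * γ / b) ≤ (1 - θc) / 2)
    -- node U3's printed-ingredient bracket, the window, the common rate
    (hU : LipBackground EA W κ CU) (hG : PolyLipGrowth CU g Pg q) (hPg : 0 ≤ Pg)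
    (hgA : ∀ K, g K ∈ W) (hgB : ∀ K, (fun i => g (K + 1) (i + 1)) ∈ W)
    (hθ' : max ω θc < θ') (hθ₅' : θ₅ ≤ θ') (hθ₃' : θ₃ ≤ θ') (hθ'1 : θ' < 1) (hθ'Λ : θ' ≤ Λg)
    -- the END's format binders on `R.dom`
    (hfmtA : ∀ K t τ, P K t τ = ∫ v, (∏ X ∈ fac K t τ,
      Real.exp (EA (g K) (uA K v) X - EA (g K) oneA X)) * oA K t τ v ∂(μ K t τ))
    (hfmtB : ∀ K t τ, Q K t τ = ∫ v, (∏ X ∈ fac K t τ,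
      Real.exp (EB (fun i => g (K + 1) (i + 1)) (uB K v) X - EB (fun i => g (K + 1) (i + 1)) oneB X)) *
        oB K t τ v ∂(μ K t τ))
    (hint : ∀ K t, |t| ≤ l₀ → ∀ τ ∈ T K \ Bad K t,
      Integrable (fun v => (∏ X ∈ fac K t τ, Real.exp (EA (g K) (uA K v) X - EA (g K) oneA X)) *
        oA K t τ v) (μ K t τ) ∧
      Integrable (fun v => (∏ X ∈ fac K t τ,
        Real.exp (EB (fun i => g (K + 1) (i + 1)) (uB K v) X - EB (fun i => g (K + 1) (i + 1)) oneB X)) *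
        oB K t τ v) (μ K t τ))
    (hsc : ∀ K t, |t| ≤ l₀ → ∀ τ ∈ T K \ Bad K t, ∀ X ∈ fac K t τ, C.scale X ≤ K)
    (hposO : ∀ K t, |t| ≤ l₀ → ∀ τ ∈ T K \ Bad K t, ∀ v ∈ R.dom, 0 < oA K t τ v ∧ 0 < oB K t τ v)
    (hoff : ∀ K t, |t| ≤ l₀ → ∀ τ ∈ T K \ Bad K t, ∀ v, v ∉ R.dom →
      (∏ X ∈ fac K t τ, Real.exp (EA (g K) (uA K v) X - EA (g K) oneA X)) * oA K t τ v = 0 ∧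
      (∏ X ∈ fac K t τ,
        Real.exp (EB (fun i => g (K + 1) (i + 1)) (uB K v) X - EB (fun i => g (K + 1) (i + 1)) oneB X)) *
        oB K t τ v = 0)
    (hS : ∀ K t, |t| ≤ l₀ → ∀ τ ∈ T K \ Bad K t, ∀ v ∈ R.dom, ∀ j ≤ K,
      |(∑ X ∈ fac K t τ with C.scale X = j,
          (Real.log (Real.exp (EB (fun i => g (K + 1) (i + 1)) (uB K v) X
              - EB (fun i => g (K + 1) (i + 1)) oneB X))
            - Real.log (Real.exp (EA (g K) (uA K v) X - EA (g K) oneA X)))) - κ₁ K t τ j| ≤ S K t τ j)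
    (hM : ∀ K t, |t| ≤ l₀ → ∀ τ ∈ T K \ Bad K t,
      Multiplicity (fac K t τ) C.scale (fun X => Real.exp (-(κ * C.d X))) Cw vol Λg K)
    (hO : ∀ K t, |t| ≤ l₀ → ∀ τ ∈ T K \ Bad K t, ∀ v ∈ R.dom,
      |Real.log (oB K t τ v) - Real.log (oA K t τ v) - cO K t τ| ≤ RO K t τ)
    (hvol : 0 ≤ vol) (hE₀ : 0 ≤ E₀) (ha0 : 0 < a) (ha1 : a < 1)
    -- the SIZE binder in the (2.43)-window profile (twin file `N19SizeWindow`; `m = 0` = all-regular)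
    (hSle : ∀ K t, |t| ≤ l₀ → ∀ τ ∈ T K \ Bad K t, ∀ j ≤ K,
      S K t τ j ≤ vol * (E₀ * ((K : ℝ) + 1) ^ m * a ^ (K - j)))
    (hRO : ∀ K t, |t| ≤ l₀ → ∀ τ ∈ T K \ Bad K t, RO K t τ ≤ vol * rO K) (hrO : Summable rO)
    -- hazard H-U5b-1, uniformly in the rate constant
    (hdevU : ∀ Cr : ℝ, 0 ≤ Cr → ∃ c₀ s : ℕ → ℝ, Summable s ∧ ∀ K t, |t| ≤ l₀ → ∀ τ ∈ T K \ Bad K t,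
      |((∑ j ∈ range (K + 1), sliceCentre (κ₁ K t τ)
          (fun j => ∑ X ∈ fac K t τ with C.scale X = j,
            (-(EB (fun i => g (K + 1) (i + 1)) oneB X - EA (g K) oneA X)))
          (S K t τ) (fun j => Cw * vol * (Cr * θ' ^ j * Λg ^ (K - j))) j) + cO K t τ) - c₀ K| ≤ vol * s K) :
    ∃ δ : ℕ → ℝ, NE7.Core l₀ vol T Bad P Q δ ∧ Summable δ := by
  obtain ⟨a₀, ha₀, hUK⟩ := uRateUpTo_of_spine gIR h22.1 h22.2 hω hU hG hPg h18 hθ₅ hC₅ h16.pointwise hC₃ h16.rate_nonneg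
    h16.rate_lt_one hgd hγ hb hθc0 hθc1 hc hCβ hrun hbox hpin h17 hL hΛβ hlo hsmall hgA hgB hθ' hθ₅' hθ₃'
  have hθ'0 : 0 < θ' := lt_of_le_of_lt (hθc0.le.trans (le_max_right ω θc)) hθ'
  have hC₉ : 0 ≤ C₉ := fadingMemory_const_nonneg h22.2
  have hCr : 0 ≤ a₀ + C₉ * (γ ^ 3 * (2 * c / (1 - θc))) * (θ' / (θ' - max ω θc)) + C₅ := by
    have h1 : 0 ≤ 2 * c / (1 - θc) := div_nonneg (mul_nonneg zero_le_two hc) (by linarith)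
    have h2 : 0 ≤ θ' / (θ' - max ω θc) := div_nonneg hθ'0.le (sub_pos.mpr hθ').le
    have h3 : 0 ≤ γ ^ 3 * (2 * c / (1 - θc)) := mul_nonneg (pow_nonneg hγ.le 3) h1
    exact add_nonneg (add_nonneg ha₀ (mul_nonneg (mul_nonneg hC₉ h3) h2)) hC₅
  obtain ⟨c₀, s, hs, hdev⟩ := hdevU _ hCr
  have hT := termBudget_of_towerRate_sizeProfile (E := fun K : ℕ => E₀ * ((K : ℝ) + 1) ^ m) hUK hCr hθ'0.le
    (hθ'0.le.trans hθ'Λ) hfmtA hfmtB hint hsc hposO hoff hS hM hO hvol (fun K => by positivity) ha0.le hSle hRO hdev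
  exact ⟨_, core_summable_of_termBudget hT (summable_eBranch_windowSize hE₀ hCr ha0 ha1 hθ'0 hθ'1 hθ'Λ) hrO hs⟩

end SpineNodes

/-! ## §3 The K5 join for this clause: N20 · N21 · (N19 ∧ U4′) ⇒ `HybridNE7` ⇒ node U5's TARGET per string -/

section Join

variable {σ : Type} [DecidableEq σ] {l₀ vol : ℝ} {T : ℕ → Finset σ} {A B shA shB : ℕ → ℝ → σ → ℝ}
  {Bad : ℕ → ℝ → Finset σ} {W Wsh : ℕ → ℝ}

/-- **THE K5 JOIN (node N27's structure) FOR THE CLAUSE OF §1–§2**: node N20 (`RelWeightBound`, NE7b), node N21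
(`ShellWeightBound`, NE7c), the bookkeeping `W + Wsh < 1`, and node N19 ∧ U4′ in the form the knit delivers them —
`∃ δ, Spine.NE7.Core l₀ vol T Bad (A − shA) (B − shB) δ ∧ Summable δ` on the shell-free cores — give a `HybridNE7` datum
(`Spine.NE7.hybridNE7_of_core` BY NAME, the constructor of the crux's BC3 skeleton). [folklore] -/
theorem hybridNE7_of_core_exists (h20 : RelWeightBound l₀ T A B Bad W)
    (h21 : ShellWeightBound l₀ T A B shA shB Wsh) (hlt : ∀ K, W K + Wsh K < 1)
    (h19 : ∃ δ : ℕ → ℝ,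
      NE7.Core l₀ vol T Bad (fun K t τ => A K t τ - shA K t τ) (fun K t τ => B K t τ - shB K t τ) δ ∧ Summable δ) :
    ∃ δ : ℕ → ℝ, HybridNE7 l₀ vol T A B Bad W shA shB Wsh δ := by
  obtain ⟨δ, hcore, hδ⟩ := h19
  exact ⟨δ, NE7.hybridNE7_of_core h20 h21 hlt hδ hcore⟩

open Missing T4Continuum in
/-- **NODE U5's TARGET FOR A STRING, from the K5 join** (the YM-DAG's `N19target = Spine.NE7.Target`): for a `TorusScheme`
with `β_K ≥ 0` and measurable observables bounded by `1`, a string `os`, `0 ≤ l₀`, `0 < vol`, the E1∕E2 dictionary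
identifying the string's dressed partition functions after `K₀ + K` ∕ `K₀ + K + 1` steps with the two runs' class sums on
`|t| ≤ l₀`, and the inputs of `hybridNE7_of_core_exists` ⇒ `∃ δ′, Spine.NE7.Target vol l₀ δ′ (schemeZ S os)`
(`= MatchingModConstants ∧ Summable δ′`), positivity discharged and the head `K < K₀` free
(`T4MatchingClosure.stringHybridNE7_intro` + `T4MatchingAssembly.matchingModConstants_schemeZ` BY NAME). [folklore] -/
theorem target_of_core_exists {G : Type*} [GaugeGroup G] [MeasurableSpace G] [RegularGaugeGroup G] [HaarData G]
    {O : Type*} (S : TorusScheme G O) (hβ : ∀ K, 0 ≤ S.β K) (hm : ∀ K o, Measurable (S.obs K o))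
    (h1 : ∀ K o U, |S.obs K o U| ≤ 1) (hl₀ : 0 ≤ l₀) (hvol : 0 < vol) (os : List O) (K₀ : ℕ)
    (hZA : ∀ K t, |t| ≤ l₀ → T4GenFunBounds.schemeZ S os (K₀ + K) t = ∑ τ ∈ T K, A K t τ)
    (hZB : ∀ K t, |t| ≤ l₀ → T4GenFunBounds.schemeZ S os (K₀ + K + 1) t = ∑ τ ∈ T K, B K t τ)
    (h20 : RelWeightBound l₀ T A B Bad W) (h21 : ShellWeightBound l₀ T A B shA shB Wsh) (hlt : ∀ K, W K + Wsh K < 1)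
    (h19 : ∃ δ : ℕ → ℝ,
      NE7.Core l₀ vol T Bad (fun K t τ => A K t τ - shA K t τ) (fun K t τ => B K t τ - shB K t τ) δ ∧ Summable δ) :
    ∃ δ' : ℕ → ℝ, NE7.Target vol l₀ δ' (T4GenFunBounds.schemeZ S os) := by
  obtain ⟨δ, h⟩ := hybridNE7_of_core_exists h20 h21 hlt h19
  obtain ⟨δ', hδ', hM⟩ := matchingModConstants_schemeZ S hβ hm h1 hl₀ hvol os (stringHybridNE7_intro S os K₀ h hZA hZB)
  exact ⟨δ', hM, hδ'⟩

end Join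

end Summit.QuantumFields.YangMills.BalabanUVNodes.N19CoreKnit
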